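import Mathlib
import HarnessLib
import Summits.AtomisticToContinuum.Crystallization.Theorems.PricedLinkCensusSoftFourRingsTypeOCell
import Summits.AtomisticToContinuum.Crystallization.Theorems.PricedLinkCensusSoftFourRingsTypeData
import Summits.AtomisticToContinuum.Crystallization.Theorems.PricedLinkCensusSoftFourRingsTypePairs
import Summits.AtomisticToContinuum.Crystallization.Theorems.PricedLinkCensusSoftFourRingsApex

/-!
# Soft four-rings, endgame: type-O bookkeeping for the cuboctahedral branch

Support file for `SoftFourRings` (route `PricedLinkCensus`, sub-problem `Crystallization`),
endgame step (E5) of the evidence file (§12.8), point-level form.  Type-O data `(a, b, c, d)`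
at `u` means `N(u) = {a, b, c, d}`, `a ∼ b`, `c ∼ d`, and the four cross pairs are non-bonds.

* `typeO_swap_pairs`, `typeO_swap12` — symmetries of type-O data;
* `typeO_complete` — type-O data is recovered from one bonded pair and one further neighbour;
* `alpha_of_typeO` — if the end `a` of the bonded pair `{a, b}` is itself of type O, then
  `{a, b}` has no common neighbour other than `u` (the hypothesis `hα` of the cell lemma);
* `typeO_cells` — point form of `typeO_common_neighbours`: `a` has a common bond `x ∉ N[u]`
  with one of `c, d`, and `b` with the other.
-/

namespace Summit.AtomisticToContinuum.Crystallization.Theorems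

open Real RealInnerProductSpace Literature.Geometry.DiscreteGeometry

section Pairs

variable {B : Finset (Finset (EuclideanSpace ℝ (Fin 3)))}

/-- Type-O data: swap the two bonded pairs. -/
theorem typeO_swap_pairs {u a b c d : EuclideanSpace ℝ (Fin 3)}
    (hN : ∀ y, ({u, y} : Finset (EuclideanSpace ℝ (Fin 3))) ∈ B ↔ (y = a ∨ y = b ∨ y = c ∨ y = d))
    (hd : a ≠ b ∧ a ≠ c ∧ a ≠ d ∧ b ≠ c ∧ b ≠ d ∧ c ≠ d)
    (hab : ({a, b} : Finset (EuclideanSpace ℝ (Fin 3))) ∈ B)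
    (hcd : ({c, d} : Finset (EuclideanSpace ℝ (Fin 3))) ∈ B)
    (hac : ({a, c} : Finset (EuclideanSpace ℝ (Fin 3))) ∉ B)
    (had : ({a, d} : Finset (EuclideanSpace ℝ (Fin 3))) ∉ B)
    (hbc : ({b, c} : Finset (EuclideanSpace ℝ (Fin 3))) ∉ B)
    (hbd : ({b, d} : Finset (EuclideanSpace ℝ (Fin 3))) ∉ B) :
    (∀ y, ({u, y} : Finset (EuclideanSpace ℝ (Fin 3))) ∈ B ↔ (y = c ∨ y = d ∨ y = a ∨ y = b)) ∧
    (c ≠ d ∧ c ≠ a ∧ c ≠ b ∧ d ≠ a ∧ d ≠ b ∧ a ≠ b) ∧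
    ({c, d} : Finset (EuclideanSpace ℝ (Fin 3))) ∈ B ∧
    ({a, b} : Finset (EuclideanSpace ℝ (Fin 3))) ∈ B ∧
    ({c, a} : Finset (EuclideanSpace ℝ (Fin 3))) ∉ B ∧
    ({c, b} : Finset (EuclideanSpace ℝ (Fin 3))) ∉ B ∧
    ({d, a} : Finset (EuclideanSpace ℝ (Fin 3))) ∉ B ∧
    ({d, b} : Finset (EuclideanSpace ℝ (Fin 3))) ∉ B := by
  refine ⟨fun y => (hN y).trans or4_rot2, ⟨hd.2.2.2.2.2, hd.2.1.symm, hd.2.2.2.1.symm, hd.2.2.1.symm,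
    hd.2.2.2.2.1.symm, hd.1⟩, hcd, hab, ?_, ?_, ?_, ?_⟩ <;> rw [Finset.pair_comm]
  exacts [hac, hbc, had, hbd]

/-- Type-O data: swap inside the first bonded pair. -/
theorem typeO_swap12 {u a b c d : EuclideanSpace ℝ (Fin 3)}
    (hN : ∀ y, ({u, y} : Finset (EuclideanSpace ℝ (Fin 3))) ∈ B ↔ (y = a ∨ y = b ∨ y = c ∨ y = d))
    (hd : a ≠ b ∧ a ≠ c ∧ a ≠ d ∧ b ≠ c ∧ b ≠ d ∧ c ≠ d)
    (hab : ({a, b} : Finset (EuclideanSpace ℝ (Fin 3))) ∈ B)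
    (hcd : ({c, d} : Finset (EuclideanSpace ℝ (Fin 3))) ∈ B)
    (hac : ({a, c} : Finset (EuclideanSpace ℝ (Fin 3))) ∉ B)
    (had : ({a, d} : Finset (EuclideanSpace ℝ (Fin 3))) ∉ B)
    (hbc : ({b, c} : Finset (EuclideanSpace ℝ (Fin 3))) ∉ B)
    (hbd : ({b, d} : Finset (EuclideanSpace ℝ (Fin 3))) ∉ B) :
    (∀ y, ({u, y} : Finset (EuclideanSpace ℝ (Fin 3))) ∈ B ↔ (y = b ∨ y = a ∨ y = c ∨ y = d)) ∧
    (b ≠ a ∧ b ≠ c ∧ b ≠ d ∧ a ≠ c ∧ a ≠ d ∧ c ≠ d) ∧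
    ({b, a} : Finset (EuclideanSpace ℝ (Fin 3))) ∈ B ∧
    ({c, d} : Finset (EuclideanSpace ℝ (Fin 3))) ∈ B ∧
    ({b, c} : Finset (EuclideanSpace ℝ (Fin 3))) ∉ B ∧
    ({b, d} : Finset (EuclideanSpace ℝ (Fin 3))) ∉ B ∧
    ({a, c} : Finset (EuclideanSpace ℝ (Fin 3))) ∉ B ∧
    ({a, d} : Finset (EuclideanSpace ℝ (Fin 3))) ∉ B := by
  refine ⟨fun y => (hN y).trans or4_swap12, ⟨hd.1.symm, hd.2.2.2.1, hd.2.2.2.2.1, hd.2.1, hd.2.2.1,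
    hd.2.2.2.2.2⟩, by rw [Finset.pair_comm]; exact hab, hcd, hbc, hbd, hac, had⟩

/-- **Completing type-O data** from one bonded pair `{m₁, m₂}` and a further neighbour `t`. -/
theorem typeO_complete {u a b c d m₁ m₂ t : EuclideanSpace ℝ (Fin 3)}
    (hN : ∀ y, ({u, y} : Finset (EuclideanSpace ℝ (Fin 3))) ∈ B ↔ (y = a ∨ y = b ∨ y = c ∨ y = d))
    (hd : a ≠ b ∧ a ≠ c ∧ a ≠ d ∧ b ≠ c ∧ b ≠ d ∧ c ≠ d)
    (hab : ({a, b} : Finset (EuclideanSpace ℝ (Fin 3))) ∈ B)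
    (hcd : ({c, d} : Finset (EuclideanSpace ℝ (Fin 3))) ∈ B)
    (hac : ({a, c} : Finset (EuclideanSpace ℝ (Fin 3))) ∉ B)
    (had : ({a, d} : Finset (EuclideanSpace ℝ (Fin 3))) ∉ B)
    (hbc : ({b, c} : Finset (EuclideanSpace ℝ (Fin 3))) ∉ B)
    (hbd : ({b, d} : Finset (EuclideanSpace ℝ (Fin 3))) ∉ B)
    (hm : ({m₁, m₂} : Finset (EuclideanSpace ℝ (Fin 3))) ∈ B)
    (hm₁ : ({u, m₁} : Finset (EuclideanSpace ℝ (Fin 3))) ∈ B)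
    (hm₂ : ({u, m₂} : Finset (EuclideanSpace ℝ (Fin 3))) ∈ B) (hm₁₂ : m₁ ≠ m₂)
    (ht : ({u, t} : Finset (EuclideanSpace ℝ (Fin 3))) ∈ B) (ht₁ : t ≠ m₁) (ht₂ : t ≠ m₂) :
    ∃ t', (∀ y, ({u, y} : Finset (EuclideanSpace ℝ (Fin 3))) ∈ B ↔
        (y = m₁ ∨ y = m₂ ∨ y = t ∨ y = t')) ∧
      (m₁ ≠ m₂ ∧ m₁ ≠ t ∧ m₁ ≠ t' ∧ m₂ ≠ t ∧ m₂ ≠ t' ∧ t ≠ t') ∧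
      ({m₁, m₂} : Finset (EuclideanSpace ℝ (Fin 3))) ∈ B ∧
      ({t, t'} : Finset (EuclideanSpace ℝ (Fin 3))) ∈ B ∧
      ({m₁, t} : Finset (EuclideanSpace ℝ (Fin 3))) ∉ B ∧
      ({m₁, t'} : Finset (EuclideanSpace ℝ (Fin 3))) ∉ B ∧
      ({m₂, t} : Finset (EuclideanSpace ℝ (Fin 3))) ∉ B ∧
      ({m₂, t'} : Finset (EuclideanSpace ℝ (Fin 3))) ∉ B := by
  -- a uniform finishing step, once the data is oriented as `(m₁, m₂, t, t')`
  have finish : ∀ {p q r s : EuclideanSpace ℝ (Fin 3)},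
      (∀ y, ({u, y} : Finset (EuclideanSpace ℝ (Fin 3))) ∈ B ↔ (y = p ∨ y = q ∨ y = r ∨ y = s)) →
      (p ≠ q ∧ p ≠ r ∧ p ≠ s ∧ q ≠ r ∧ q ≠ s ∧ r ≠ s) →
      ({p, q} : Finset (EuclideanSpace ℝ (Fin 3))) ∈ B →
      ({r, s} : Finset (EuclideanSpace ℝ (Fin 3))) ∈ B →
      ({p, r} : Finset (EuclideanSpace ℝ (Fin 3))) ∉ B →
      ({p, s} : Finset (EuclideanSpace ℝ (Fin 3))) ∉ B →
      ({q, r} : Finset (EuclideanSpace ℝ (Fin 3))) ∉ B →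
      ({q, s} : Finset (EuclideanSpace ℝ (Fin 3))) ∉ B →
      m₁ = p → m₂ = q → (t = r ∨ t = s) →
      ∃ t', (∀ y, ({u, y} : Finset (EuclideanSpace ℝ (Fin 3))) ∈ B ↔
          (y = m₁ ∨ y = m₂ ∨ y = t ∨ y = t')) ∧
        (m₁ ≠ m₂ ∧ m₁ ≠ t ∧ m₁ ≠ t' ∧ m₂ ≠ t ∧ m₂ ≠ t' ∧ t ≠ t') ∧
        ({m₁, m₂} : Finset (EuclideanSpace ℝ (Fin 3))) ∈ B ∧
        ({t, t'} : Finset (EuclideanSpace ℝ (Fin 3))) ∈ B ∧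
        ({m₁, t} : Finset (EuclideanSpace ℝ (Fin 3))) ∉ B ∧
        ({m₁, t'} : Finset (EuclideanSpace ℝ (Fin 3))) ∉ B ∧
        ({m₂, t} : Finset (EuclideanSpace ℝ (Fin 3))) ∉ B ∧
        ({m₂, t'} : Finset (EuclideanSpace ℝ (Fin 3))) ∉ B := by
    intro p q r s hN' hd' hpq hrs hpr hps hqr hqs e1 e2 e3
    subst e1 e2
    rcases e3 with rfl | rfl
    · exact ⟨s, hN', hd', hpq, hrs, hpr, hps, hqr, hqs⟩
    · refine ⟨r, fun y => (hN' y).trans ?_, ⟨hd'.1, hd'.2.2.1, hd'.2.1, hd'.2.2.2.2.1, hd'.2.2.2.1,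
        hd'.2.2.2.2.2.symm⟩, hpq, by rw [Finset.pair_comm]; exact hrs, hps, hpr, hqs, hqr⟩
      constructor
      · rintro (h | h | h | h)
        exacts [Or.inl h, Or.inr (Or.inl h), Or.inr (Or.inr (Or.inr h)), Or.inr (Or.inr (Or.inl h))]
      · rintro (h | h | h | h)
        exacts [Or.inl h, Or.inr (Or.inl h), Or.inr (Or.inr (Or.inr h)), Or.inr (Or.inr (Or.inl h))]
  have hm₁' := (hN m₁).1 hm₁
  have hm₂' := (hN m₂).1 hm₂
  have ht' := (hN t).1 ht
  rcases bond_pair_typeO hac had hbc hbd hm₁' hm₂' hm₁₂ hm with h | h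
  · obtain ⟨e₁ | e₁, e₂ | e₂⟩ := mem_or_of_pair_eq h
    · exact absurd (e₁.trans e₂.symm) hm₁₂
    · have htt : t = c ∨ t = d := by
        rcases ht' with e | e | e | e
        exacts [absurd (e.trans e₁.symm) ht₁, absurd (e.trans e₂.symm) ht₂, Or.inl e, Or.inr e]
      exact finish hN hd hab hcd hac had hbc hbd e₁ e₂ htt
    · obtain ⟨hN', hd', hba, hcd', hbc', hbd', hac', had'⟩ := typeO_swap12 hN hd hab hcd hac had hbc hbd
      have htt : t = c ∨ t = d := by
        rcases ht' with e | e | e | e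
        exacts [absurd (e.trans e₂.symm) ht₂, absurd (e.trans e₁.symm) ht₁, Or.inl e, Or.inr e]
      exact finish hN' hd' hba hcd' hbc' hbd' hac' had' e₁ e₂ htt
    · exact absurd (e₁.trans e₂.symm) hm₁₂
  · obtain ⟨hN', hd', hcd', hab', hca, hcb, hda, hdb⟩ := typeO_swap_pairs hN hd hab hcd hac had hbc hbd
    obtain ⟨e₁ | e₁, e₂ | e₂⟩ := mem_or_of_pair_eq h
    · exact absurd (e₁.trans e₂.symm) hm₁₂
    · have htt : t = a ∨ t = b := by
        rcases ht' with e | e | e | e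
        exacts [Or.inl e, Or.inr e, absurd (e.trans e₁.symm) ht₁, absurd (e.trans e₂.symm) ht₂]
      exact finish hN' hd' hcd' hab' hca hcb hda hdb e₁ e₂ htt
    · obtain ⟨hN'', hd'', hdc, hab'', hda', hdb', hca', hcb'⟩ :=
        typeO_swap12 hN' hd' hcd' hab' hca hcb hda hdb
      have htt : t = a ∨ t = b := by
        rcases ht' with e | e | e | e
        exacts [Or.inl e, Or.inr e, absurd (e.trans e₂.symm) ht₂, absurd (e.trans e₁.symm) ht₁]
      exact finish hN'' hd'' hdc hab'' hda' hdb' hca' hcb' e₁ e₂ htt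
    · exact absurd (e₁.trans e₂.symm) hm₁₂

/-- **`hα` from type O at the end of the bond**: if `a` (bonded to `u` and `b`, with `u ∼ b`) is
of type O, then no `z ≠ u` is bonded to both `a` and `b`. -/
theorem alpha_of_typeO {u a b z p q r s : EuclideanSpace ℝ (Fin 3)}
    (hNa : ∀ y, ({a, y} : Finset (EuclideanSpace ℝ (Fin 3))) ∈ B ↔ (y = p ∨ y = q ∨ y = r ∨ y = s))
    (hda : p ≠ q ∧ p ≠ r ∧ p ≠ s ∧ q ≠ r ∧ q ≠ s ∧ r ≠ s)
    (hpr : ({p, r} : Finset (EuclideanSpace ℝ (Fin 3))) ∉ B)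
    (hps : ({p, s} : Finset (EuclideanSpace ℝ (Fin 3))) ∉ B)
    (hqr : ({q, r} : Finset (EuclideanSpace ℝ (Fin 3))) ∉ B)
    (hqs : ({q, s} : Finset (EuclideanSpace ℝ (Fin 3))) ∉ B)
    (hua : ({u, a} : Finset (EuclideanSpace ℝ (Fin 3))) ∈ B)
    (hub : ({u, b} : Finset (EuclideanSpace ℝ (Fin 3))) ∈ B) (hub' : u ≠ b)
    (hab : ({a, b} : Finset (EuclideanSpace ℝ (Fin 3))) ∈ B)
    (hza : ({z, a} : Finset (EuclideanSpace ℝ (Fin 3))) ∈ B)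
    (hzb : ({z, b} : Finset (EuclideanSpace ℝ (Fin 3))) ∈ B) (hzb' : z ≠ b) : z = u := by
  by_contra hzu
  have hu' := (hNa u).1 (by rw [Finset.pair_comm]; exact hua)
  have hb' := (hNa b).1 hab
  have hz' := (hNa z).1 (by rw [Finset.pair_comm]; exact hza)
  have h1 := bond_pair_typeO hpr hps hqr hqs hu' hb' hub' hub
  have h2 := bond_pair_typeO hpr hps hqr hqs hz' hb' hzb' hzb
  have hsame : ({u, b} : Finset (EuclideanSpace ℝ (Fin 3))) ≠ {z, b} := by
    intro e
    rcases (mem_or_of_pair_eq e).1 with h | h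
    · exact hzu h.symm
    · exact hub' h
  have hdisj : ∀ {x y : EuclideanSpace ℝ (Fin 3)},
      ({x, b} : Finset (EuclideanSpace ℝ (Fin 3))) = {p, q} →
      ({y, b} : Finset (EuclideanSpace ℝ (Fin 3))) = {r, s} → False := by
    intro x y e1 e2
    rcases (mem_or_of_pair_eq e1).2 with h | h <;> rcases (mem_or_of_pair_eq e2).2 with h' | h'
    · exact hda.2.1 (h.symm.trans h')
    · exact hda.2.2.1 (h.symm.trans h')
    · exact hda.2.2.2.1 (h.symm.trans h')
    · exact hda.2.2.2.2.1 (h.symm.trans h')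
  rcases h1 with h1 | h1 <;> rcases h2 with h2 | h2
  · exact hsame (h1.trans h2.symm)
  · exact hdisj h1 h2
  · exact hdisj h2 h1
  · exact hsame (h1.trans h2.symm)

end Pairs


section Setting

variable {X : Finset (EuclideanSpace ℝ (Fin 3))} {B : Finset (Finset (EuclideanSpace ℝ (Fin 3)))}
  (hT : musinTarasov2012_tammes_thirteen) (hX1 : ∀ y ∈ X, ‖y‖ = 1) (hcard : X.card = 12)
  (hsepX : ∀ u ∈ X, ∀ u' ∈ X, u ≠ u' → ⟪u, u'⟫ ≤ 1 - 1 / (2 * (101 / 100 : ℝ) ^ 2))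
  (hB : ∀ T ∈ B, ∃ u ∈ X, ∃ u' ∈ X, u ≠ u' ∧ 1 - (101 / 100 : ℝ) ^ 2 / 2 ≤ ⟪u, u'⟫ ∧ T = {u, u'})
  (hBcard : B.card = 24)
  (hdeg : ∀ v ∈ X, ∃ w : Fin 4 → EuclideanSpace ℝ (Fin 3), (∀ k, w k ∈ X) ∧
    Function.Injective w ∧ (∀ k, w k ≠ v) ∧
    (∀ k, ({v, w k} : Finset (EuclideanSpace ℝ (Fin 3))) ∈ B) ∧
    ∀ y, ({v, y} : Finset (EuclideanSpace ℝ (Fin 3))) ∈ B → ∃ k, y = w k)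

include hT hX1 hcard hsepX hB hBcard hdeg in
open scoped Classical in
/-- **The cells at a type-O vertex, point form**: with type-O data `(a, b, c, d)` at `u` and no
common neighbour of `a, b` other than `u`, the point `a` has a common bond `x ∉ N[u]` with one of
`c, d` and `b` a common bond `y ∉ N[u]` with the other. -/
theorem typeO_cells {u a b c d : EuclideanSpace ℝ (Fin 3)} (hu : u ∈ X)
    (hN : ∀ y, ({u, y} : Finset (EuclideanSpace ℝ (Fin 3))) ∈ B ↔ (y = a ∨ y = b ∨ y = c ∨ y = d))
    (hd : a ≠ b ∧ a ≠ c ∧ a ≠ d ∧ b ≠ c ∧ b ≠ d ∧ c ≠ d)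
    (hab : ({a, b} : Finset (EuclideanSpace ℝ (Fin 3))) ∈ B) (hcd : ({c, d} : Finset (EuclideanSpace ℝ (Fin 3))) ∈ B)
    (hac : ({a, c} : Finset (EuclideanSpace ℝ (Fin 3))) ∉ B) (had : ({a, d} : Finset (EuclideanSpace ℝ (Fin 3))) ∉ B)
    (hbc : ({b, c} : Finset (EuclideanSpace ℝ (Fin 3))) ∉ B) (hbd : ({b, d} : Finset (EuclideanSpace ℝ (Fin 3))) ∉ B)
    (hα : ∀ z, ({z, a} : Finset (EuclideanSpace ℝ (Fin 3))) ∈ B → ({z, b} : Finset (EuclideanSpace ℝ (Fin 3))) ∈ B → z = u) :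
    ((∃ x ∈ X, x ≠ u ∧ x ≠ a ∧ x ≠ b ∧ x ≠ c ∧ x ≠ d ∧
        ({x, a} : Finset (EuclideanSpace ℝ (Fin 3))) ∈ B ∧ ({x, c} : Finset (EuclideanSpace ℝ (Fin 3))) ∈ B) ∧
      (∃ y ∈ X, y ≠ u ∧ y ≠ a ∧ y ≠ b ∧ y ≠ c ∧ y ≠ d ∧
        ({y, b} : Finset (EuclideanSpace ℝ (Fin 3))) ∈ B ∧ ({y, d} : Finset (EuclideanSpace ℝ (Fin 3))) ∈ B)) ∨
    ((∃ x ∈ X, x ≠ u ∧ x ≠ a ∧ x ≠ b ∧ x ≠ c ∧ x ≠ d ∧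
        ({x, a} : Finset (EuclideanSpace ℝ (Fin 3))) ∈ B ∧ ({x, d} : Finset (EuclideanSpace ℝ (Fin 3))) ∈ B) ∧
      (∃ y ∈ X, y ≠ u ∧ y ≠ a ∧ y ≠ b ∧ y ≠ c ∧ y ≠ d ∧
        ({y, b} : Finset (EuclideanSpace ℝ (Fin 3))) ∈ B ∧ ({y, c} : Finset (EuclideanSpace ℝ (Fin 3))) ∈ B)) := by
  obtain ⟨hab', hac', had', hbc', hbd', hcd'⟩ := hd
  set w : Fin 4 → EuclideanSpace ℝ (Fin 3) := ![a, b, c, d] with hw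
  have hwinj : Function.Injective w := injective_vec4 hab' hac' had' hbc' hbd' hcd'
  have hvw : ∀ k, ({u, w k} : Finset (EuclideanSpace ℝ (Fin 3))) ∈ B := by
    intro k
    fin_cases k
    · exact (hN a).2 (Or.inl rfl)
    · exact (hN b).2 (Or.inr (Or.inl rfl))
    · exact (hN c).2 (Or.inr (Or.inr (Or.inl rfl)))
    · exact (hN d).2 (Or.inr (Or.inr (Or.inr rfl)))
  have hwX : ∀ k, w k ∈ X := fun k => (mem_of_mem_bonds hB (hvw k)).2
  have hwv : ∀ k, w k ≠ u := fun k => (ne_of_mem_bonds hB (hvw k)).symm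
  have hvonly : ∀ y, ({u, y} : Finset (EuclideanSpace ℝ (Fin 3))) ∈ B → ∃ k, y = w k := by
    intro y hy
    rw [exists_fin_four_iff]
    exact (hN y).1 hy
  have hnd : [(0 : Fin 4), 1, 2, 3].Nodup := by decide
  have hBij : ({w 0, w 1} : Finset (EuclideanSpace ℝ (Fin 3))) ∈ B := hab
  have hBkl : ({w 2, w 3} : Finset (EuclideanSpace ℝ (Fin 3))) ∈ B := hcd
  have hNB : ∀ p q : Fin 4, p ≠ q → ({w p, w q} : Finset (EuclideanSpace ℝ (Fin 3))) ∈ B →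
      ({p, q} : Finset (Fin 4)) = {0, 1} ∨ ({p, q} : Finset (Fin 4)) = {2, 3} := by
    intro p q _ hBpq
    fin_cases p <;> fin_cases q
    all_goals
      simp only [hw, Fin.zero_eta, Fin.mk_one, Fin.isValue, Fin.reduceFinMk,
        Matrix.cons_val_zero, Matrix.cons_val_one, Matrix.cons_val] at hBpq
    all_goals first
      | (left; decide)
      | (right; decide)
      | (exfalso; exact (ne_of_mem_bonds hB hBpq) rfl)
      | (exfalso; exact hac hBpq)
      | (exfalso; exact had hBpq)
      | (exfalso; exact hbc hBpq)
      | (exfalso; exact hbd hBpq)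
      | (exfalso; rw [Finset.pair_comm] at hBpq; exact hac hBpq)
      | (exfalso; rw [Finset.pair_comm] at hBpq; exact had hBpq)
      | (exfalso; rw [Finset.pair_comm] at hBpq; exact hbc hBpq)
      | (exfalso; rw [Finset.pair_comm] at hBpq; exact hbd hBpq)
  have hα' : ∀ z, ({z, w 0} : Finset (EuclideanSpace ℝ (Fin 3))) ∈ B → ({z, w 1} : Finset (EuclideanSpace ℝ (Fin 3))) ∈ B → z = u := hα
  rcases typeO_common_neighbours hT hX1 hcard hsepX hB hBcard hdeg hu w hwX hwinj hwv hvw hvonly hnd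
      hNB hα' (i := 0) (j := 1) (k := 2) (l := 3) hBij hBkl with
    ⟨⟨x, hxX, hxu, hxw, hB1, hB2⟩, ⟨y, hyX, hyu, hyw, hB3, hB4⟩⟩ |
    ⟨⟨x, hxX, hxu, hxw, hB1, hB2⟩, ⟨y, hyX, hyu, hyw, hB3, hB4⟩⟩
  · exact Or.inl ⟨⟨x, hxX, hxu, hxw 0, hxw 1, hxw 2, hxw 3, hB1, hB2⟩,
      ⟨y, hyX, hyu, hyw 0, hyw 1, hyw 2, hyw 3, hB3, hB4⟩⟩
  · exact Or.inr ⟨⟨x, hxX, hxu, hxw 0, hxw 1, hxw 2, hxw 3, hB1, hB2⟩,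
      ⟨y, hyX, hyu, hyw 0, hyw 1, hyw 2, hyw 3, hB3, hB4⟩⟩

end Setting

end Summit.AtomisticToContinuum.Crystallization.Theorems
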